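import Mathlib
import Literature.NumberTheory.LFunctions.SuzukiCanonicalSystem
import Summits.RiemannHypothesis.RiemannHypothesis.Theorems.DeBrangesSuzukiDoorDefs
import Summits.RiemannHypothesis.RiemannHypothesis.Theorems.SuzukiWeightedDoorConverse
import Summits.RiemannHypothesis.RiemannHypothesis.Theorems.SuzukiWeightedDoorDoor
import Summits.RiemannHypothesis.RiemannHypothesis.Theorems.SuzukiWindowsDoorConverseInnerSymbol
import Summits.RiemannHypothesis.RiemannHypothesis.Theorems.SuzukiWindowsDoorConverseLaplace
import Summits.RiemannHypothesis.RiemannHypothesis.Theorems.SuzukiWindowsDoorConverseDoor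
import Summits.RiemannHypothesis.RiemannHypothesis.Theses.SuzukiWindowsDoor

/-!
# v6 «SuzukiWindowsDoorConverse» — module 7/7: RH ⇒ all windows; the single-operator RH-EQUIVALENCE

RH-EQUIVALENCE statements (labels: every theorem here is an RH-FREE implication or an `↔` with `RiemannHypothesis` on
one side; NOTHING here bears on the truth of RH):
* `noUnitEigenvalue_limKernel_of_xiZeroFree` — `ξ ≠ 0` on `Re s > 1/2` ⇒ ∀ θ > 10 ∀ t, `NoUnitEigenvalue K_θ t`
  (inputs discharged: inner symbol `InnerSymbol`, kernel growth + holomorphy `SuzukiWeightedDoorConverse` (v5, σ₀ = 1/2),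
  symbol rigidity `SuzukiWeightedDoorDoor.xi_ne_zero_of_symbolQuotientOn` (v5, η = −1));
* `noUnitEigenvalue_limKernel_of_riemannHypothesis` — the same from `RiemannHypothesis` (Mathlib's statement);
* `allWindows_iff_riemannHypothesis` — GIVEN the route-2 rung leaf `AllWindowsDetectRH` (B-P(P2), proved modulo the crux
  `WindowsImplyContraction`, itself proved in the cell's folder), for each fixed `θ > 10`:
  `(∀ t ≥ 0, NoUnitEigenvalue K_θ t) ↔ RiemannHypothesis` — [Su20, arXiv:1907.07302, p.2]'s single-operator wish, typed.
-/

set_option linter.dupNamespace false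

open MeasureTheory Set Complex

namespace Summit.RiemannHypothesis.RiemannHypothesis.Theorems.SuzukiWindowsDoorConverse

open Literature.NumberTheory.LFunctions (riemannXi NoUnitEigenvalue)
open Summit.RiemannHypothesis.RiemannHypothesis.Theorems.SuzukiWeightedDoorConverse
  (abs_limKernel_le_of_zeroFree differentiableOn_thetaSym_of_zeroFree)
open Summit.RiemannHypothesis.RiemannHypothesis.Theorems.SuzukiWeightedDoorDoor (xi_ne_zero_of_symbolQuotientOn)

/-- **RH-EQUIVALENCE (converse half), inputs discharged.**  `ξ ≠ 0` on `Re s > 1/2` ⇒ for every `θ > 10` and every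
`t`, `±1` is not an eigenvalue of the `(−t,t)`-window of Suzuki's single operator `K_θ`.  RH-FREE implication. -/
theorem noUnitEigenvalue_limKernel_of_xiZeroFree {θ : ℝ} (hθ : 10 < θ)
    (hZ : ∀ s : ℂ, 1 / 2 < s.re → riemannXi s ≠ 0) (t : ℝ) :
    NoUnitEigenvalue (SuzukiDoor.limKernel θ) t := by
  have hθ1 : 1 < θ := by linarith
  -- kernel growth at every rate 4δ (v5, σ₀ = 1/2)
  have hGrowth : ∀ δ : ℝ, 0 < δ → δ ≤ 1 / 16 → ∃ D : ℝ, ∀ x : ℝ,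
      |SuzukiDoor.limKernel θ x| ≤ D * Real.exp (4 * δ * x) := by
    intro δ hδ hδ16
    obtain ⟨D, hD⟩ := abs_limKernel_le_of_zeroFree (σ₀ := 1 / 2) hθ le_rfl (by norm_num) hZ hδ hδ16
    exact ⟨D, fun x => by simpa using hD x⟩
  -- holomorphy of Θ_θ on ℂ₊ (v5, σ₀ = 1/2)
  have hTheta : DifferentiableOn ℂ (SuzukiDoor.limTheta θ) {z : ℂ | 0 < z.im} := by
    have h := differentiableOn_thetaSym_of_zeroFree θ hZ
    have hset : {z : ℂ | (1 / 2 : ℝ) - 1 / 2 < z.im} = {z : ℂ | 0 < z.im} := by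
      ext z; simp
    rw [hset] at h
    exact h
  refine noUnitEigenvalue_of_inputs hθ1 (fun z hz => norm_limTheta_le_one_of_xiZeroFree (by linarith) hZ hz)
    (fun z hz => laplace_limKernel_eq_limTheta hθ1 hGrowth hTheta hz) hGrowth ?_ t
  intro G F hG hF hF0 hGF
  exact xi_ne_zero_of_symbolQuotientOn (θ := θ) (a := 1 / 2) (η := -1) (by linarith) le_rfl (by norm_num)
    hG hF hF0 hGF

/-- **RH ⇒ all windows** (RH-EQUIVALENCE bookkeeping; RH-FREE implication with Mathlib's `RiemannHypothesis` as the
hypothesis): for every `θ > 10` and every `t`, `NoUnitEigenvalue K_θ t`. -/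
theorem noUnitEigenvalue_limKernel_of_riemannHypothesis (hRH : RiemannHypothesis) {θ : ℝ} (hθ : 10 < θ) (t : ℝ) :
    NoUnitEigenvalue (SuzukiDoor.limKernel θ) t :=
  noUnitEigenvalue_limKernel_of_xiZeroFree hθ (xiZeroFree_half_of_riemannHypothesis hRH) t

/-- **The single-operator RH-EQUIVALENCE, typed** ([Su20] p.2's wish for one operator instead of the family):
GIVEN the route's rung leaf `AllWindowsDetectRH` (door direction), for each fixed `θ > 10`,
`(∀ t ≥ 0, ±1 ∉ spec K_θ[t]) ↔ RH`.  An RH-EQUIVALENCE statement; nothing here bears on the truth of RH. -/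
theorem allWindows_iff_riemannHypothesis
    (hLeaf : Summit.RiemannHypothesis.RiemannHypothesis.Theses.SuzukiWindowsDoor.AllWindowsDetectRH)
    {θ : ℝ} (hθ : 10 < θ) :
    (∀ t : ℝ, 0 ≤ t → NoUnitEigenvalue (SuzukiDoor.limKernel θ) t) ↔ RiemannHypothesis :=
  ⟨fun hAll => hLeaf θ hθ hAll, fun hRH t _ => noUnitEigenvalue_limKernel_of_riemannHypothesis hRH hθ t⟩

end Summit.RiemannHypothesis.RiemannHypothesis.Theorems.SuzukiWindowsDoorConverse
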